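import Summits.NavierStokesRegularity.NavierStokesRegularity.Theorems.RellichScarScarRigidityBiotSavartKernel
import Summits.NavierStokesRegularity.NavierStokesRegularity.Theorems.RellichScarScarRigidityBiotSavartMoments
import Summits.NavierStokesRegularity.NavierStokesRegularity.Theorems.RellichScarScarRigidityCoulombPoisson
import HarnessLib

/-!
# `ScarRigidity`, line `moment-conditioned-rellich` — stub `stub_biotSavartFarField` (BS), part 3:
# the far field of the Newtonian potential of a density with vanishing moments of order `≤ 2`

Crux stmt-NavierStokesRegularity-11717 (route RellichScar), helper file (`--supports`) for the registered stub
`stub_biotSavartFarField` (skeleton `Cruxes/ScarRigidity/Lines/moment_conditioned_rellich.lean`).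

**Main result** (`exists_farField_newtonPotential_bound`): for every order `k` there is `C = C(k)` such that for
every smooth density `F : ℝ³ → ℝ³` with `‖F‖ ≤ N a⁴/(‖y‖+a)⁷`, `‖DᵏF‖ ≤ N a⁴/(‖y‖+a)^{7+k}` and
`∫ F = 0`, `∫ y_l F = 0`, `∫ y_l y_n F = 0`, the potential `u = Γ ⋆ F` obeys, for `‖x₀‖ ≥ a`,

  `‖Dᵏu(x₀)‖ ≤ C N a³ / ‖x₀‖^{4+k}`.

Proof: split `Γ = Γ₀ + Γ∞` at the scale `c = ‖x₀‖/4` (`newtonNear/newtonFar (c) (2c)`).  The near piece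
`u₁ = ∫ Γ₀(z) • F(· − z) dz` is differentiated on the density (`…ApexRegularityKernel`): on the support
`‖z‖ < ‖x₀‖/2` of `Γ₀`, `‖DᵏF(x₀ − z)‖ ≤ N a⁴ (‖x₀‖/2)^{-7-k}`, against `∫|Γ₀^{c,2c}| = c² ∫|Γ₀^{1,2}|`.  The far
piece `u₂ = ∫ Γ∞(· − y) • F(y) dy` is differentiated on the kernel (part 1): `Dᵏu₂(x₀) m = ∫ g(y) • F(y) dy`
with `g(y) = DᵏΓ∞(x₀ − y) m`, whose third derivative is bounded by `(∏‖mᵢ‖) c^{-(k+4)} sup‖Dᵏ⁺³Γ∞^{1,2}‖`;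
subtracting the second-order Taylor polynomial of `g` at `0` costs nothing (the moments vanish, part 2) and
leaves `∫ C‖y‖³‖F‖ ≤ C N I a³`.
-/

noncomputable section

open Set Filter Function MeasureTheory Metric TopologicalSpace
open scoped Topology ContDiff

set_option linter.dupNamespace false -- D-0017: `Summit.<S>.<S>.…` repeats the summit name by design

-- nested operator types (`ℝ³ [×n]→L[ℝ] ℝ` applied under `iteratedFDeriv`)
set_option maxSynthPendingDepth 4

namespace Summit.NavierStokesRegularity.NavierStokesRegularity.Theorems.RellichScarScarRigidity

open Literature.Analysis.FluidPDE

/-! ### The near piece -/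

/-- **The near piece at scale `c = ‖x₀‖/4`.** For `F ∈ Cᵏ` with `‖DᵏF(y)‖ ≤ N a⁴/(‖y‖+a)^{7+k}` and
`0 < a ≤ ‖x₀‖`: `‖Dᵏ(∫ Γ₀^{c,2c}(z) • F(· − z) dz)(x₀)‖ ≤ (J 2^{3+k}) N a³/‖x₀‖^{4+k}`, `J = ∫ |Γ₀^{1,2}|`. [folklore] -/
theorem norm_iteratedFDeriv_nearPiece_le {k : ℕ} {F : EuclideanSpace ℝ (Fin 3) → EuclideanSpace ℝ (Fin 3)}
    (hF : ContDiff ℝ k F) {N a : ℝ} (ha : 0 < a) (hN : 0 ≤ N)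
    (hFk : ∀ y, ‖iteratedFDeriv ℝ k F y‖ ≤ N * a ^ 4 / (‖y‖ + a) ^ (7 + k))
    {x₀ : EuclideanSpace ℝ (Fin 3)} (hx : a ≤ ‖x₀‖) :
    ‖iteratedFDeriv ℝ k (fun x => ∫ z, newtonNear (‖x₀‖ / 4 * 1) (‖x₀‖ / 4 * 2) z • F (x - z)) x₀‖ ≤
      (∫ w, |newtonNear (1 : ℝ) 2 w|) * 2 ^ (3 + k) * N * a ^ 3 / ‖x₀‖ ^ (4 + k) := by
  set R : ℝ := ‖x₀‖ with hR
  have hR0 : 0 < R := ha.trans_le hx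
  set c : ℝ := R / 4 with hc
  have hc0 : 0 < c := by positivity
  have hc1 : (0 : ℝ) ≤ c * 1 := by positivity
  have hc12 : c * 1 < c * 2 := by linarith
  have hk0 : Integrable (newtonNear (c * 1) (c * 2)) := integrable_newtonNear hc1 hc12
  have hk0ρ : ∀ z : EuclideanSpace ℝ (Fin 3), c * 2 < ‖z‖ → newtonNear (c * 1) (c * 2) z = 0 :=
    newtonNear_eq_zero_of_lt hc1 hc12
  set J : ℝ := ∫ w, |newtonNear (1 : ℝ) 2 w| with hJ
  have hJ0 : 0 ≤ J := integral_nonneg fun _ => abs_nonneg _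
  refine ContinuousMultilinearMap.opNorm_le_bound (by positivity) fun m => ?_
  rw [iteratedFDeriv_integral_smul_comp_sub_apply hk0 hk0ρ k hF x₀ m]
  set P : ℝ := ∏ i, ‖m i‖ with hP
  clear_value P
  have hP0 : 0 ≤ P := hP ▸ Finset.prod_nonneg fun i _ => norm_nonneg _
  -- pointwise bound on the support of `Γ₀`
  have hX0 : 0 ≤ N * a ^ 4 / (R / 2) ^ (7 + k) * P := by positivity
  set X : ℝ := N * a ^ 4 / (R / 2) ^ (7 + k) * P with hX
  clear_value X
  have hpt : ∀ z, ‖newtonNear (c * 1) (c * 2) z • iteratedFDeriv ℝ k F (x₀ - z) m‖ ≤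
      |newtonNear (c * 1) (c * 2) z| * X := by
    intro z
    rw [norm_smul, Real.norm_eq_abs, hX]
    by_cases hz : c * 2 ≤ ‖z‖
    · rw [newtonNear_eq_zero hc1 hc12 hz, abs_zero, zero_mul, zero_mul]
    · refine mul_le_mul_of_nonneg_left ?_ (abs_nonneg _)
      have hz' : ‖z‖ < R / 2 := by rw [hc] at hz; linarith [not_le.1 hz]
      have hxz : R / 2 ≤ ‖x₀ - z‖ := by
        have := norm_sub_norm_le x₀ z
        linarith
      have hρ : R / 2 ≤ ‖x₀ - z‖ + a := by linarith
      calc ‖iteratedFDeriv ℝ k F (x₀ - z) m‖ ≤ ‖iteratedFDeriv ℝ k F (x₀ - z)‖ * P :=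
            hP ▸ ContinuousMultilinearMap.le_opNorm _ _
        _ ≤ N * a ^ 4 / (‖x₀ - z‖ + a) ^ (7 + k) * P := mul_le_mul_of_nonneg_right (hFk _) hP0
        _ ≤ N * a ^ 4 / (R / 2) ^ (7 + k) * P := by
            refine mul_le_mul_of_nonneg_right (div_le_div_of_nonneg_left (by positivity) (by positivity)
              (pow_le_pow_left₀ (by positivity) hρ _)) hP0
  have hcont : Continuous fun y => iteratedFDeriv ℝ k F y m :=
    (ContinuousMultilinearMap.apply ℝ (fun _ : Fin k => EuclideanSpace ℝ (Fin 3)) (EuclideanSpace ℝ (Fin 3))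
      m).continuous.comp (hF.continuous_iteratedFDeriv le_rfl)
  have hint : Integrable (fun z => newtonNear (c * 1) (c * 2) z • iteratedFDeriv ℝ k F (x₀ - z) m) volume :=
    integrable_smul_comp_sub hk0 hk0ρ hcont x₀
  calc ‖∫ z, newtonNear (c * 1) (c * 2) z • iteratedFDeriv ℝ k F (x₀ - z) m‖
      ≤ ∫ z, ‖newtonNear (c * 1) (c * 2) z • iteratedFDeriv ℝ k F (x₀ - z) m‖ :=
        norm_integral_le_integral_norm _
    _ ≤ ∫ z, |newtonNear (c * 1) (c * 2) z| * X := integral_mono hint.norm (hk0.abs.mul_const X) hpt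
    _ = c ^ 2 * J * X := by rw [integral_mul_const, integral_abs_newtonNear_scale hc0]
    _ = J * 2 ^ (3 + k) * (N * P) * (a ^ 4 / R ^ (5 + k)) := by
        rw [hX, hc, div_pow, div_pow]
        field_simp
        ring
    _ ≤ J * 2 ^ (3 + k) * (N * P) * (a ^ 3 / R ^ (4 + k)) := by
        refine mul_le_mul_of_nonneg_left ?_ (by positivity)
        rw [div_le_div_iff₀ (by positivity) (by positivity), pow_succ a 3,
          show R ^ (5 + k) = R ^ (4 + k) * R by ring, mul_assoc]
        refine mul_le_mul_of_nonneg_left ?_ (by positivity)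
        rw [mul_comm]
        exact mul_le_mul_of_nonneg_left hx (by positivity)
    _ = J * 2 ^ (3 + k) * N * a ^ 3 / ‖x₀‖ ^ (4 + k) * P := by rw [hR]; ring

/-! ### The far piece -/

/-- Integrability and vanishing of the moments of `F` against the diagonal of a continuous multilinear form of
order `1` or `2`, from the coordinate moments (growth `‖M‖‖y‖ⁿ` against the septic apex bound). [folklore] -/
theorem integrable_multilinear_smul_of_apexBound_seven {n : ℕ} (hn : n ≤ 2)
    {F : EuclideanSpace ℝ (Fin 3) → EuclideanSpace ℝ (Fin 3)} (hFc : Continuous F) {N a : ℝ} (ha : 0 < a)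
    (hF : ∀ y, ‖F y‖ ≤ N * a ^ 4 / (‖y‖ + a) ^ 7)
    (M : ContinuousMultilinearMap ℝ (fun _ : Fin n => EuclideanSpace ℝ (Fin 3)) ℝ) :
    Integrable (fun y : EuclideanSpace ℝ (Fin 3) => (M fun _ => y) • F y) volume := by
  refine integrable_smul_of_growth_of_apexBound_seven hFc ha hF (d := n) (Q := ‖M‖)
    (M.coe_continuous.comp (continuous_pi fun _ => continuous_id)) hn fun y => ?_
  calc ‖M fun _ => y‖ ≤ ‖M‖ * ∏ _i : Fin n, ‖y‖ := M.le_opNorm _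
    _ = ‖M‖ * ‖y‖ ^ n := by rw [Finset.prod_const, Finset.card_univ, Fintype.card_fin]

/-- **The far piece at scale `c = ‖x₀‖/4`.** For every order `k` there is `C` with: for a continuous density
`F` with `‖F(y)‖ ≤ N a⁴/(‖y‖+a)⁷`, vanishing moments of order `≤ 2`, and `0 < a ≤ ‖x₀‖`,
`‖Dᵏ(∫ Γ∞^{c,2c}(· − y) • F(y) dy)(x₀)‖ ≤ C N a³/‖x₀‖^{4+k}` (`C = 4^{k+4} I sup‖Dᵏ⁺³Γ∞^{1,2}‖`). [folklore] -/
theorem exists_norm_iteratedFDeriv_farPiece_le (k : ℕ) :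
    ∃ C : ℝ, 0 ≤ C ∧ ∀ (F : EuclideanSpace ℝ (Fin 3) → EuclideanSpace ℝ (Fin 3)) (N a : ℝ)
      (x₀ : EuclideanSpace ℝ (Fin 3)), Continuous F → 0 < a → a ≤ ‖x₀‖ →
      (∀ y, ‖F y‖ ≤ N * a ^ 4 / (‖y‖ + a) ^ 7) →
      (∫ y, F y = 0) → (∀ l : Fin 3, ∫ y, (y l) • F y = 0) → (∀ l n : Fin 3, ∫ y, (y l * y n) • F y = 0) →
      ‖iteratedFDeriv ℝ k (fun x => ∫ y, newtonFar (‖x₀‖ / 4 * 1) (‖x₀‖ / 4 * 2) (x - y) • F y) x₀‖ ≤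
        C * N * a ^ 3 / ‖x₀‖ ^ (4 + k) := by
  obtain ⟨B, hB0, hB⟩ := exists_norm_iteratedFDeriv_newtonFar_le (3 + k)
  set I : ℝ := ∫ z : EuclideanSpace ℝ (Fin 3), ‖z‖ ^ 3 * ((‖z‖ + 1) ^ 7)⁻¹ with hI
  have hI0 : 0 ≤ I := integral_nonneg fun z => by positivity
  clear_value I
  refine ⟨B * 4 ^ (3 + k + 1) * I, by positivity, ?_⟩
  intro F N a x₀ hFc ha hx hF0 hM0 hM1 hM2
  have hN : 0 ≤ N := nonneg_of_apexBound ha hF0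
  set R : ℝ := ‖x₀‖ with hR
  have hR0 : 0 < R := ha.trans_le hx
  set c : ℝ := R / 4 with hc
  have hc0 : 0 < c := by positivity
  clear_value c R
  obtain ⟨hΓs, hΓb⟩ := newtonFar_scale_smooth_bounded hc0
  have hFi : Integrable F volume := integrable_of_apexBound_seven hFc ha hF0
  refine ContinuousMultilinearMap.opNorm_le_bound (by positivity) fun m => ?_
  rw [iteratedFDeriv_integral_boundedKernel_smul_apply k hΓs hΓb hFc hFi x₀ m]
  set P : ℝ := ∏ i, ‖m i‖ with hP
  clear_value P
  have hP0 : 0 ≤ P := hP ▸ Finset.prod_nonneg fun i _ => norm_nonneg _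
  -- the scalar kernel `g(y) = DᵏΓ∞(x₀ - y) m`
  set G : EuclideanSpace ℝ (Fin 3) → ℝ := fun w => iteratedFDeriv ℝ k (newtonFar (c * 1) (c * 2)) w m with hG
  have hGs : ContDiff ℝ ∞ G :=
    (ContinuousMultilinearMap.apply ℝ (fun _ : Fin k => EuclideanSpace ℝ (Fin 3)) ℝ m).contDiff.comp
      (hΓs.iteratedFDeriv_right le_rfl)
  set g : EuclideanSpace ℝ (Fin 3) → ℝ := fun y => G (x₀ - y) with hg
  have hg3 : ContDiff ℝ 3 g := (contDiff_infty.1 hGs 3).comp (contDiff_const.sub contDiff_id)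
  -- its third derivative is bounded by `CT`
  have hCT0 : 0 ≤ P * (c⁻¹ ^ (3 + k + 1) * B) := by positivity
  set CT : ℝ := P * (c⁻¹ ^ (3 + k + 1) * B) with hCT
  clear_value CT
  have hgb : ∀ z, ‖iteratedFDeriv ℝ 3 g z‖ ≤ CT := by
    intro z
    have e : g = fun y => (G ∘ (LinearIsometryEquiv.neg ℝ : EuclideanSpace ℝ (Fin 3) ≃ₗᵢ[ℝ]
        EuclideanSpace ℝ (Fin 3))) (y - x₀) := by
      funext y
      simp only [hg, Function.comp_apply, LinearIsometryEquiv.coe_neg, neg_sub]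
    rw [e, iteratedFDeriv_comp_sub, LinearIsometryEquiv.norm_iteratedFDeriv_comp_right, hCT]
    calc ‖iteratedFDeriv ℝ 3 G _‖ ≤ P * ‖iteratedFDeriv ℝ (3 + k) (newtonFar (c * 1) (c * 2)) _‖ :=
          hP ▸ norm_iteratedFDeriv_iteratedFDeriv_apply_le k hΓs 3 m _
      _ ≤ P * (c⁻¹ ^ (3 + k + 1) * B) :=
          mul_le_mul_of_nonneg_left (norm_iteratedFDeriv_newtonFar_scale_le hB hc0 _) hP0
  -- the Taylor polynomial of `g` at `0` integrates to zero against `F`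
  set T : EuclideanSpace ℝ (Fin 3) → ℝ := fun y =>
    g 0 + iteratedFDeriv ℝ 1 g 0 (fun _ => y) + (1 / 2 : ℝ) * iteratedFDeriv ℝ 2 g 0 (fun _ => y) with hT
  have hT0i : Integrable (fun y => (g 0) • F y) volume := hFi.smul (g 0)
  have hT1i := integrable_multilinear_smul_of_apexBound_seven (by norm_num) hFc ha hF0 (iteratedFDeriv ℝ 1 g 0)
  have hT2i := integrable_multilinear_smul_of_apexBound_seven le_rfl hFc ha hF0 (iteratedFDeriv ℝ 2 g 0)
  have hTe : (fun y => T y • F y) = fun y => (g 0) • F y + (iteratedFDeriv ℝ 1 g 0 fun _ => y) • F y +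
      (1 / 2 : ℝ) • ((iteratedFDeriv ℝ 2 g 0 fun _ => y) • F y) := by
    funext y
    simp only [hT, add_smul, mul_smul]
  have hT01i : Integrable (fun y => (g 0) • F y + (iteratedFDeriv ℝ 1 g 0 fun _ => y) • F y) volume :=
    hT0i.add hT1i
  have hT2i' : Integrable (fun y => (1 / 2 : ℝ) • ((iteratedFDeriv ℝ 2 g 0 fun _ => y) • F y)) volume :=
    hT2i.smul (1 / 2 : ℝ)
  have hTi : Integrable (fun y => T y • F y) volume := by
    rw [hTe]; exact hT01i.add hT2i'
  have hT0 : ∫ y, T y • F y = 0 := by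
    rw [hTe, integral_add hT01i hT2i', integral_add hT0i hT1i, integral_smul, hM0,
      smul_zero, zero_add, integral_multilinear_one_smul_eq_zero
        (integrable_coord_smul_of_apexBound_seven hFc ha hF0) hM1, zero_add, integral_smul,
      integral_multilinear_two_smul_eq_zero (integrable_coord_mul_coord_smul_of_apexBound_seven hFc ha hF0)
        hM2, smul_zero]
  -- `g • F` is integrable (`g` is bounded and continuous)
  obtain ⟨Bk, hBk⟩ := hΓb k
  have hgi : Integrable (fun y => g y • F y) volume := by
    refine integrable_smul_of_growth_of_apexBound_seven hFc ha hF0 (d := 0) (Q := Bk * P) hg3.continuous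
      (by norm_num) fun y => ?_
    rw [pow_zero, mul_one]
    calc ‖g y‖ ≤ ‖iteratedFDeriv ℝ k (newtonFar (c * 1) (c * 2)) (x₀ - y)‖ * P :=
          hP ▸ ContinuousMultilinearMap.le_opNorm _ _
      _ ≤ Bk * P := mul_le_mul_of_nonneg_right (hBk _) hP0
  -- the remainder estimate
  obtain ⟨h3i, h3⟩ := integral_norm_cube_mul_norm_le hFc ha hF0
  rw [← hI] at h3
  have hdi : Integrable (fun y => (g y - T y) • F y) volume := by
    simp_rw [sub_smul]; exact hgi.sub hTi
  have hrem : ∀ y, ‖(g y - T y) • F y‖ ≤ CT * (‖y‖ ^ 3 * ‖F y‖) := by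
    intro y
    rw [norm_smul, ← mul_assoc]
    refine mul_le_mul_of_nonneg_right ?_ (norm_nonneg _)
    have h := norm_sub_taylor_two_le hg3 hgb y
    calc ‖g y - T y‖ = ‖g y - g 0 - iteratedFDeriv ℝ 1 g 0 (fun _ => y) -
          (1 / 2 : ℝ) * iteratedFDeriv ℝ 2 g 0 (fun _ => y)‖ := by
            rw [hT]; congr 1; ring
      _ ≤ CT * ‖y‖ ^ 3 := h
  have hsub : ∫ y, g y • F y = ∫ y, (g y - T y) • F y := by
    simp_rw [sub_smul]
    rw [integral_sub hgi hTi, hT0, sub_zero]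
  calc ‖∫ y, g y • F y‖ = ‖∫ y, (g y - T y) • F y‖ := by rw [hsub]
    _ ≤ ∫ y, ‖(g y - T y) • F y‖ := norm_integral_le_integral_norm _
    _ ≤ ∫ y, CT * (‖y‖ ^ 3 * ‖F y‖) := integral_mono hdi.norm (h3i.const_mul CT) hrem
    _ = CT * ∫ y, ‖y‖ ^ 3 * ‖F y‖ := integral_const_mul _ _
    _ ≤ CT * (N * I * a ^ 3) := mul_le_mul_of_nonneg_left h3 (hCT ▸ hCT0)
    _ = B * 4 ^ (3 + k + 1) * I * N * a ^ 3 / R ^ (4 + k) * P := by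
        rw [hCT, hc, inv_div, div_pow]
        have hR' : R ≠ 0 := hR0.ne'
        field_simp
        ring

/-! ### The far field of the Newtonian potential -/

/-- **Far field of the Newtonian potential of a density with vanishing moments of order `≤ 2`.**  For every
`k` there is `C = C(k)` such that: if `F ∈ C^∞(ℝ³; ℝ³)` obeys `‖F(y)‖ ≤ N a⁴/(‖y‖+a)⁷`,
`‖DᵏF(y)‖ ≤ N a⁴/(‖y‖+a)^{7+k}`, `∫ F = 0`, `∫ y_l F = 0`, `∫ y_l y_n F = 0` (`a > 0`), then for `‖x₀‖ ≥ a`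

  `‖Dᵏ (Γ ⋆ F)(x₀)‖ ≤ C N a³ / ‖x₀‖^{4+k}`

(near/far split of `Γ` at the scale `‖x₀‖/4`; Stein, *Singular Integrals*, III §3, for the expansion).
[folklore] -/
theorem exists_farField_newtonPotential_bound (k : ℕ) :
    ∃ C : ℝ, 0 ≤ C ∧ ∀ (F : EuclideanSpace ℝ (Fin 3) → EuclideanSpace ℝ (Fin 3)) (N a : ℝ)
      (x₀ : EuclideanSpace ℝ (Fin 3)), ContDiff ℝ (⊤ : ℕ∞) F → 0 < a → a ≤ ‖x₀‖ →
      (∀ y, ‖F y‖ ≤ N * a ^ 4 / (‖y‖ + a) ^ 7) →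
      (∀ y, ‖iteratedFDeriv ℝ k F y‖ ≤ N * a ^ 4 / (‖y‖ + a) ^ (7 + k)) →
      (∫ y, F y = 0) → (∀ l : Fin 3, ∫ y, (y l) • F y = 0) → (∀ l n : Fin 3, ∫ y, (y l * y n) • F y = 0) →
      ‖iteratedFDeriv ℝ k (fun x => ∫ y, newtonKernel (x - y) • F y) x₀‖ ≤ C * N * a ^ 3 / ‖x₀‖ ^ (4 + k) := by
  obtain ⟨C₂, hC₂, h₂⟩ := exists_norm_iteratedFDeriv_farPiece_le k
  set J : ℝ := ∫ w, |newtonNear (1 : ℝ) 2 w| with hJ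
  have hJ0 : 0 ≤ J := integral_nonneg fun _ => abs_nonneg _
  clear_value J
  refine ⟨J * 2 ^ (3 + k) + C₂, by positivity, ?_⟩
  intro F N a x₀ hF ha hx hF0 hFk hM0 hM1 hM2
  have hN : 0 ≤ N := nonneg_of_apexBound ha hF0
  have hR0 : 0 < ‖x₀‖ := ha.trans_le hx
  have hc0 : 0 < ‖x₀‖ / 4 := by positivity
  have hc1 : (0 : ℝ) ≤ ‖x₀‖ / 4 * 1 := by positivity
  have hc12 : ‖x₀‖ / 4 * 1 < ‖x₀‖ / 4 * 2 := by linarith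
  have hFc : Continuous F := hF.continuous
  have hFi : Integrable F volume := integrable_of_apexBound_seven hFc ha hF0
  have hk0 : Integrable (newtonNear (‖x₀‖ / 4 * 1) (‖x₀‖ / 4 * 2)) := integrable_newtonNear hc1 hc12
  have hk0ρ := newtonNear_eq_zero_of_lt hc1 hc12
  obtain ⟨hΓs, hΓb⟩ := newtonFar_scale_smooth_bounded hc0
  have hFk' : ContDiff ℝ k F := hF.of_le (by exact_mod_cast le_top)
  -- `u = u₁ + u₂`
  have hsplit : (fun x => ∫ y, newtonKernel (x - y) • F y) =
      (fun x => ∫ z, newtonNear (‖x₀‖ / 4 * 1) (‖x₀‖ / 4 * 2) z • F (x - z)) +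
        fun x => ∫ y, newtonFar (‖x₀‖ / 4 * 1) (‖x₀‖ / 4 * 2) (x - y) • F y := by
    funext x
    obtain ⟨hnear, hne⟩ := integral_kernel_sub_smul_eq_comp_sub hk0 hk0ρ hFc x
    obtain ⟨B₀, hB₀⟩ := hΓb 0
    obtain ⟨B₁, hB₁⟩ := hΓb 1
    have hfar := (hasFDerivAt_integral_boundedKernel_smul (hΓs.of_le (by exact_mod_cast le_top))
      (fun z => by rw [← norm_iteratedFDeriv_zero (𝕜 := ℝ)]; exact hB₀ z)
      (fun z => by rw [← norm_iteratedFDeriv_one]; exact hB₁ z) hFc hFi x).1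
    have e : (fun y => newtonKernel (x - y) • F y) = fun y =>
        newtonNear (‖x₀‖ / 4 * 1) (‖x₀‖ / 4 * 2) (x - y) • F y +
          newtonFar (‖x₀‖ / 4 * 1) (‖x₀‖ / 4 * 2) (x - y) • F y := by
      funext y
      rw [← add_smul, newtonNear_add_newtonFar]
    rw [Pi.add_apply, e, integral_add hnear hfar, hne]
  have hu₁ : ContDiff ℝ k (fun x => ∫ z, newtonNear (‖x₀‖ / 4 * 1) (‖x₀‖ / 4 * 2) z • F (x - z)) :=
    contDiff_integral_smul_comp_sub hk0 hk0ρ k hFk'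
  have hu₂ : ContDiff ℝ k (fun x => ∫ y, newtonFar (‖x₀‖ / 4 * 1) (‖x₀‖ / 4 * 2) (x - y) • F y) :=
    contDiff_integral_boundedKernel_smul k hΓs hΓb hFc hFi
  rw [hsplit, iteratedFDeriv_add_apply hu₁.contDiffAt hu₂.contDiffAt]
  have h1 := norm_iteratedFDeriv_nearPiece_le hFk' ha hN hFk hx
  rw [← hJ] at h1
  have h2 := h₂ F N a x₀ hFc ha hx hF0 hM0 hM1 hM2
  calc ‖iteratedFDeriv ℝ k (fun x => ∫ z, newtonNear (‖x₀‖ / 4 * 1) (‖x₀‖ / 4 * 2) z • F (x - z)) x₀ +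
        iteratedFDeriv ℝ k (fun x => ∫ y, newtonFar (‖x₀‖ / 4 * 1) (‖x₀‖ / 4 * 2) (x - y) • F y) x₀‖
      ≤ J * 2 ^ (3 + k) * N * a ^ 3 / ‖x₀‖ ^ (4 + k) + C₂ * N * a ^ 3 / ‖x₀‖ ^ (4 + k) :=
        (norm_add_le _ _).trans (add_le_add h1 h2)
    _ = (J * 2 ^ (3 + k) + C₂) * N * a ^ 3 / ‖x₀‖ ^ (4 + k) := by ring

/-! ### Registered sub-goal -/

/-- **Registered helper stub `stub_biotSavartExpansionTools`** of `stub_biotSavartFarField` (crux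
stmt-NavierStokesRegularity-11717, line `moment-conditioned-rellich`): the far-field bound for the Newtonian
potential of a smooth septically flat density with vanishing moments of order `≤ 2`. [folklore] -/
theorem stub_biotSavartExpansionTools :
    ∀ k : ℕ, ∃ C : ℝ, 0 ≤ C ∧ ∀ (F : EuclideanSpace ℝ (Fin 3) → EuclideanSpace ℝ (Fin 3)) (N a : ℝ)
      (x₀ : EuclideanSpace ℝ (Fin 3)), ContDiff ℝ (⊤ : ℕ∞) F → 0 < a → a ≤ ‖x₀‖ →
      (∀ y, ‖F y‖ ≤ N * a ^ 4 / (‖y‖ + a) ^ 7) →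
      (∀ y, ‖iteratedFDeriv ℝ k F y‖ ≤ N * a ^ 4 / (‖y‖ + a) ^ (7 + k)) →
      (∫ y, F y = 0) → (∀ l : Fin 3, ∫ y, (y l) • F y = 0) → (∀ l n : Fin 3, ∫ y, (y l * y n) • F y = 0) →
      ‖iteratedFDeriv ℝ k (fun x => ∫ y, newtonKernel (x - y) • F y) x₀‖ ≤ C * N * a ^ 3 / ‖x₀‖ ^ (4 + k) :=
  fun k => exists_farField_newtonPotential_bound k

end Summit.NavierStokesRegularity.NavierStokesRegularity.Theorems.RellichScarScarRigidity

end
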